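import Mathlib
import HarnessLib
import Summits.FinalStateConjecture.Statement
import Literature.Geometry.Lorentzian.LandauLifshitzPseudotensor
import Summits.FinalStateConjecture.FinalStateConjecture.Theorems.EIHFluxBalanceInertialRecessionChartCalculus
import Literature.Geometry.Lorentzian.ImmersedChartRicci

/-!
# Route EIHFluxBalance — `InertialRecession`, line `sublinear-is-free-clean-window-charges`:
# the LAB METRIC of a lab chart and its Ricci bridge (helpers for stub `stub_chargeModel`)

Helper file (`--supports stmt-FinalStateConjecture-10166`) for the crux
`Summit.FinalStateConjecture.FinalStateConjecture.Theses.EIHFluxBalance.InertialRecession`.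

The stubs `stub_chargeModel`, `stub_slaving`, `stub_quasiStationarity` of the line all speak about the
**lab metric** of the crux's lab chart `Φ : U → M` over a reference background `B = ⟨U, G, t, r⟩`,
written as the total field `x ↦ G(x) + deviationExtend B Φ x` on `E4` (junk `= G` off `U`). This file
proves, for an ARBITRARY reference background `B` and smooth chart map `Φ`:

* `bilin_add_deviationExtend_eq_pullbackBilin` — on `U` the lab metric IS the field of components of
  the pulled-back spacetime metric, `G + (Φ^*g − G) = Φ^*g` (so the junk of `G` inside the holes is
  irrelevant on `U`);
* `bilin_add_deviationExtend_symm`, `contDiffOn_bilin_add_deviationExtend` — it is symmetric and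
  `C^∞` on `U` (`contMDiff_pullbackBilin_holds` read through the trivialisation of the bundle of
  bilinear forms over the open subset `U ⊆ E4`, `OpensChart.contMDiffAt_bilinSection_iff`);
* `injective_mfderiv_of_nondegenerate`, `nondegenerate_of_norm_sub_minkowski_lt_one` — where the lab
  metric is nondegenerate (in particular where `‖Φ^*g − η‖ < 1`) the chart map is an immersion;
* `ricAt_bilin_add_deviationExtend_eq_zero` — **the Ricci bridge**: if the spacetime metric is Ricci
  flat (the vacuum field `VacuumCauchyDevelopment.isRicciFlat`, with the Levi-Civita instance supplied
  by `PseudoRiemannianMetric.hasLeviCivita`), then on every open `A ≤ U` on which `dΦ` is injective the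
  COORDINATE Ricci form of the lab metric vanishes, `MetricCoord.ricAt (G + deviationExtend B Φ) z = 0`
  (`z ∈ A`): the pullback metric `(Φ|_A)^* g` on the open submanifold `A` has the lab metric as its
  representative, so its Ricci tensor is `ricAt` of the lab metric (`OpensChart.ricci_eq_ricAt`,
  O'Neill 1983, Lemma 3.52), and by naturality of `Ric` under the local isometry `Φ|_A`
  (`PseudoRiemannianMetric.ricci_comap_apply`, O'Neill 1983, Prop. 3.59) it equals `Ric^g = 0` on
  pushed-forward vectors;
* `ricAt_bilin_add_deviationExtend_eq_zero_of_norm_sub_lt` — the pointwise form used by the window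
  law: `Ric = 0` of the lab metric at every `x ∈ U` with `‖(G + deviationExtend B Φ)(x) − η‖ < 1`.
-/

set_option linter.dupNamespace false

noncomputable section

open scoped Manifold ContDiff Topology
open Filter Set Function TopologicalSpace Literature.Geometry.Lorentzian

namespace Summit.FinalStateConjecture.FinalStateConjecture.Theorems

namespace LabMetric

variable (𝓢 : Spacetime 4) (B : ModelBackground) (Φ : B.domain → 𝓢.carrier)

/-! ### The lab metric is the pulled-back metric on the domain -/

/-- Evaluation form of the lab metric on the domain: `(G + deviationExtend)(x)(v, w) = g_{Φ x}(dΦ_x v, dΦ_x w)`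
for `x ∈ U` (DHRT arXiv:2104.08222, §1, definition of the deviation). [folklore] -/
theorem bilin_add_deviationExtend_apply (x : B.domain) (v w : E4) :
    (B.bilin x.1 + 𝓢.deviationExtend B Φ x.1) v w =
      𝓢.metric.val (Φ x) (mfderiv 𝓘(ℝ, E4) (𝓡 4) Φ x v) (mfderiv 𝓘(ℝ, E4) (𝓡 4) Φ x w) := by
  rw [add_apply, add_apply, 𝓢.deviationExtend_coe, Spacetime.deviation_apply]
  ring

/-- **On the reference domain the lab metric is the field of components of `Φ^* g`**:
`G(x) + (Φ^* g − G)(x) = (Φ^* g)(x)` for `x ∈ U` — so the junk values of `G` are irrelevant on `U`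
(DHRT arXiv:2104.08222, §1). [folklore] -/
theorem bilin_add_deviationExtend_eq_pullbackBilin (x : B.domain) :
    B.bilin x.1 + 𝓢.deviationExtend B Φ x.1 =
      (show E4 →L[ℝ] E4 →L[ℝ] ℝ from
        pullbackBilin (I := 𝓡 4) (I' := 𝓘(ℝ, E4)) Φ 𝓢.metric.val x) :=
  ContinuousLinearMap.ext fun v ↦ ContinuousLinearMap.ext fun w ↦
    bilin_add_deviationExtend_apply 𝓢 B Φ x v w

/-- The lab metric is symmetric on the domain (the spacetime metric is). [folklore] -/
theorem bilin_add_deviationExtend_symm (x : B.domain) (v w : E4) :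
    (B.bilin x.1 + 𝓢.deviationExtend B Φ x.1) v w = (B.bilin x.1 + 𝓢.deviationExtend B Φ x.1) w v := by
  rw [bilin_add_deviationExtend_apply, bilin_add_deviationExtend_apply]
  exact 𝓢.metric.symm (Φ x) _ _

variable {Φ}

/-- **The lab metric of a smooth chart map is `C^∞` on the reference domain** (as a map
`E4 → (E4 →L E4 →L ℝ)`): the pullback `Φ^* g` is a smooth section of the bundle of bilinear forms
over the open subset `U ⊆ E4` (`contMDiff_pullbackBilin_holds`, O'Neill 1983, Ch. 3, Lemma 3.35 ff.),
i.e. its representative is smooth (`OpensChart.contMDiffAt_bilinSection_iff`). No regularity of the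
reference field `G` is needed (it cancels). [folklore] -/
theorem contDiffOn_bilin_add_deviationExtend (hΦ : ContMDiff 𝓘(ℝ, E4) (𝓡 4) ∞ Φ) :
    ContDiffOn ℝ ∞ (fun x ↦ B.bilin x + 𝓢.deviationExtend B Φ x) B.domain := by
  intro x hx
  have hsec := PseudoRiemannianMetric.contMDiff_pullbackBilin_holds (I := 𝓡 4) (M := 𝓢.carrier)
    (I' := 𝓘(ℝ, E4)) (N := B.domain) (n := ∞) Φ hΦ 𝓢.metric.toPseudoRiemannianMetric
  have hat : ContDiffAt ℝ ∞ (fun z ↦ B.bilin z + 𝓢.deviationExtend B Φ z) x :=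
    (OpensChart.contMDiffAt_bilinSection_iff ⟨x, hx⟩
      (fun y ↦ pullbackBilin (I := 𝓡 4) (I' := 𝓘(ℝ, E4)) Φ 𝓢.metric.val y)
      (fun z ↦ B.bilin z + 𝓢.deviationExtend B Φ z)
      fun y ↦ (bilin_add_deviationExtend_eq_pullbackBilin 𝓢 B Φ y).symm).1 (hsec ⟨x, hx⟩)
  exact hat.contDiffWithinAt

/-- Continuity form of `contDiffOn_bilin_add_deviationExtend`. [folklore] -/
theorem continuousOn_bilin_add_deviationExtend (hΦ : ContMDiff 𝓘(ℝ, E4) (𝓡 4) ∞ Φ) :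
    ContinuousOn (fun x ↦ B.bilin x + 𝓢.deviationExtend B Φ x) B.domain :=
  (contDiffOn_bilin_add_deviationExtend 𝓢 B hΦ).continuousOn

/-! ### Nondegeneracy of the lab metric makes the chart map an immersion -/

variable (Φ) in
/-- **Where the lab metric is nondegenerate the chart map is an immersion**: if
`(Φ^* g)_x(v, ·) = 0 ⇒ v = 0`, then `dΦ_x` is injective (`(Φ^* g)_x(v, w) = g(dΦ v, dΦ w)`).
O'Neill 1983, Ch. 3, p. 58. [folklore] -/
theorem injective_mfderiv_of_nondegenerate (x : B.domain)
    (hnd : ∀ v : E4, (∀ w : E4, (B.bilin x.1 + 𝓢.deviationExtend B Φ x.1) v w = 0) → v = 0) :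
    Injective (mfderiv 𝓘(ℝ, E4) (𝓡 4) Φ x) := by
  refine (injective_iff_map_eq_zero _).2 fun v hv ↦ hnd v fun w ↦ ?_
  rw [bilin_add_deviationExtend_apply, hv, map_zero]
  rfl

/-- The time-reflected vector `θv = (−v⁰, v~)`: `η(v, θv) = ‖v‖²` and `‖θv‖ = ‖v‖`. [folklore] -/
theorem minkowski_apply_timeReflect (v : E4) :
    Minkowski.bilin v (v - (2 * v 0) • E4.basisVector 0) = ‖v‖ ^ 2 ∧
      ‖v - (2 * v 0) • E4.basisVector 0‖ = ‖v‖ := by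
  set w : E4 := v - (2 * v 0) • E4.basisVector 0 with hw
  have hb : ∀ ν : Fin 4, E4.basisVector 0 ν = if ν = 0 then 1 else 0 := fun ν ↦ by
    simp [E4.basisVector]
  have hc : ∀ ν : Fin 4, w ν = v ν - 2 * v 0 * E4.basisVector 0 ν := fun ν ↦ by
    simp [hw]
  have h0 : w 0 = -v 0 := by rw [hc, hb, if_pos rfl]; ring
  have h1 : w 1 = v 1 := by rw [hc, hb]; simp
  have h2 : w 2 = v 2 := by rw [hc, hb]; simp
  have h3 : w 3 = v 3 := by rw [hc, hb]; simp
  have hn : ∀ u : E4, ‖u‖ ^ 2 = u 0 ^ 2 + u 1 ^ 2 + u 2 ^ 2 + u 3 ^ 2 := fun u ↦ by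
    rw [EuclideanSpace.real_norm_sq_eq, Fin.sum_univ_four]
  refine ⟨?_, ?_⟩
  · rw [Minkowski.bilin_apply, Fin.sum_univ_three, hn]
    simp only [Fin.succ_zero_eq_one, Fin.succ_one_eq_two, show (2 : Fin 3).succ = (3 : Fin 4) from rfl,
      h0, h1, h2, h3]
    ring
  · have hw2 : ‖w‖ ^ 2 = ‖v‖ ^ 2 := by
      rw [hn, hn, h0, h1, h2, h3]
      ring
    exact (sq_eq_sq₀ (norm_nonneg _) (norm_nonneg _)).1 hw2

/-- **A bilinear form within operator distance `< 1` of `η` is nondegenerate**: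
`L(v, θv) = ‖v‖² + (L − η)(v, θv) ≥ (1 − ‖L − η‖)‖v‖² > 0` for `v ≠ 0`, `θ` the time reflection.
[folklore] -/
theorem nondegenerate_of_norm_sub_minkowski_lt_one {L : E4 →L[ℝ] E4 →L[ℝ] ℝ}
    (hL : ‖L - Minkowski.bilin‖ < 1) (v : E4) (hv : ∀ w : E4, L v w = 0) : v = 0 := by
  by_contra hne
  have hvpos : 0 < ‖v‖ := norm_pos_iff.mpr hne
  set w : E4 := v - (2 * v 0) • E4.basisVector 0 with hw
  obtain ⟨hη, hnw⟩ := minkowski_apply_timeReflect v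
  have hLvw : L v w = 0 := hv w
  have hdec : L v w = Minkowski.bilin v w + (L - Minkowski.bilin) v w := by
    rw [sub_apply, sub_apply, add_sub_cancel]
  have hbound : |(L - Minkowski.bilin) v w| ≤ ‖L - Minkowski.bilin‖ * ‖v‖ * ‖w‖ := by
    rw [← Real.norm_eq_abs]
    exact (L - Minkowski.bilin).le_opNorm₂ v w
  rw [hnw] at hbound
  have h1 : ‖L - Minkowski.bilin‖ * ‖v‖ * ‖v‖ < 1 * ‖v‖ * ‖v‖ := by gcongr
  have h2 : -(‖L - Minkowski.bilin‖ * ‖v‖ * ‖v‖) ≤ (L - Minkowski.bilin) v w := (abs_le.mp hbound).1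
  have : (0 : ℝ) < L v w := by
    rw [hdec, hη]
    nlinarith
  exact this.ne' hLvw

/-! ### The Ricci bridge -/

/-- **The Ricci bridge (open-set form).** Let `g` be the (smooth, Lorentzian) spacetime metric,
Ricci flat (`Ric(g) = 0`, hypothesis in the literal shape of `VacuumCauchyDevelopment.isRicciFlat`;
the Levi-Civita instance is supplied by `PseudoRiemannianMetric.hasLeviCivita`), `Φ : U → M` a smooth
chart map and `A ≤ U` an open subset on which `dΦ` is injective. Then the coordinate Ricci form of
the lab metric vanishes on `A`: `ricAt (G + deviationExtend B Φ) z = 0`. Proof: the pullback metric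
`(Φ|_A)^* g` on the open submanifold `A ⊆ E4` (`PseudoRiemannianMetric.comap`) has representative the
lab metric (chain rule along the inclusion `A → U`, whose differential is the identity), so its Ricci
tensor is `ricAt` of the lab metric (O'Neill 1983, Lemma 3.52, `OpensChart.ricci_eq_ricAt`) and, by
naturality under the local isometry `Φ|_A` (O'Neill 1983, Prop. 3.59,
`PseudoRiemannianMetric.ricci_comap_apply`), also `Ric^g(dΦ ·, dΦ ·) = 0`.
[cite: ONeill1983, Ch. 3, Prop. 3.59 and Lemma 3.52] -/
theorem ricAt_bilin_add_deviationExtend_eq_zero (hΦ : ContMDiff 𝓘(ℝ, E4) (𝓡 4) ∞ Φ)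
    (hRic : ∀ [𝓢.metric.toPseudoRiemannianMetric.HasLeviCivita],
      𝓢.metric.toPseudoRiemannianMetric.IsRicciFlat)
    {A : Opens E4} (hA : A ≤ B.domain)
    (hinj : ∀ z : A, Injective (mfderiv 𝓘(ℝ, E4) (𝓡 4) Φ (Opens.inclusion hA z))) (z : A) :
    MetricCoord.ricAt (fun x ↦ B.bilin x + 𝓢.deviationExtend B Φ x) z.1 = 0 := by
  set g := 𝓢.metric.toPseudoRiemannianMetric with hg
  haveI : g.HasLeviCivita := g.hasLeviCivita
  -- the restricted chart map `Φ|_A = Φ ∘ (A ↪ U)`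
  set ΦA : A → 𝓢.carrier := Φ ∘ Opens.inclusion hA with hΦA
  have hincl : ContMDiff 𝓘(ℝ, E4) 𝓘(ℝ, E4) ∞ (Opens.inclusion hA) := contMDiff_inclusion hA
  have hΦA1 : ContMDiff 𝓘(ℝ, E4) (𝓡 4) ∞ ΦA := hΦ.comp hincl
  have hΦA2 : ContMDiff 𝓘(ℝ, E4) (𝓡 4) (∞ + 1) ΦA := by
    have h : ((∞ : ℕ∞ω) + 1) = ∞ := rfl
    rw [h]
    exact hΦA1
  have hΦd : MDifferentiable 𝓘(ℝ, E4) (𝓡 4) Φ := hΦ.mdifferentiable (by simp)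
  have hid : MDifferentiable 𝓘(ℝ, E4) 𝓘(ℝ, E4) (Opens.inclusion hA) :=
    hincl.mdifferentiable (by simp)
  -- differential of the restricted map
  have hdA : ∀ (y : A) (v : E4), mfderiv 𝓘(ℝ, E4) (𝓡 4) ΦA y v =
      mfderiv 𝓘(ℝ, E4) (𝓡 4) Φ (Opens.inclusion hA y) v := by
    intro y v
    rw [hΦA, mfderiv_comp y (hΦd _) (hid y)]
    change mfderiv 𝓘(ℝ, E4) (𝓡 4) Φ (Opens.inclusion hA y)
        (mfderiv 𝓘(ℝ, E4) 𝓘(ℝ, E4) (Opens.inclusion hA) y v) = _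
    rw [OpensChart.mfderiv_inclusion_apply hA y v]
  have hinjA : ∀ y : A, Injective (mfderiv 𝓘(ℝ, E4) (𝓡 4) ΦA y) := by
    intro y v w hvw
    rw [hdA y v, hdA y w] at hvw
    exact hinj y hvw
  have hdim : Module.finrank ℝ E4 = Module.finrank ℝ (EuclideanSpace ℝ (Fin 4)) := rfl
  -- the pullback metric on the open submanifold `A`
  set g' := g.comap PseudoRiemannianMetric.contMDiff_pullbackBilin_holds ΦA hΦA2 hinjA hdim
    with hg'
  haveI : g'.HasLeviCivita := g'.hasLeviCivita
  -- its representative is the lab metric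
  have hrepr : ∀ y : A, g'.val y = (fun x ↦ B.bilin x + 𝓢.deviationExtend B Φ x) y := by
    intro y
    rw [hg', PseudoRiemannianMetric.val_comap]
    have e := bilin_add_deviationExtend_eq_pullbackBilin 𝓢 B Φ (Opens.inclusion hA y)
    change _ = B.bilin (Opens.inclusion hA y).1 + 𝓢.deviationExtend B Φ (Opens.inclusion hA y).1
    rw [e]
    ext v w
    change 𝓢.metric.val (ΦA y) (mfderiv 𝓘(ℝ, E4) (𝓡 4) ΦA y v) (mfderiv 𝓘(ℝ, E4) (𝓡 4) ΦA y w) =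
      𝓢.metric.val (Φ (Opens.inclusion hA y)) (mfderiv 𝓘(ℝ, E4) (𝓡 4) Φ (Opens.inclusion hA y) v)
        (mfderiv 𝓘(ℝ, E4) (𝓡 4) Φ (Opens.inclusion hA y) w)
    rw [hdA y v, hdA y w]
    rfl
  -- Ricci of `g'` is `ricAt` of the lab metric, and is `Ric^g` on pushed-forward vectors, i.e. `0`
  ext v w
  have h1 : g'.ricci z v w = MetricCoord.ricAt (fun x ↦ B.bilin x + 𝓢.deviationExtend B Φ x) z.1 v w :=
    OpensChart.ricci_eq_ricAt hrepr z v w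
  have h2 : g'.ricci z v w =
      g.ricci (ΦA z) (mfderiv 𝓘(ℝ, E4) (𝓡 4) ΦA z v) (mfderiv 𝓘(ℝ, E4) (𝓡 4) ΦA z w) :=
    g.ricci_comap_apply PseudoRiemannianMetric.contMDiff_pullbackBilin_holds hΦA2 hinjA hdim z v w
  have h3 : g.ricci (ΦA z) = 0 := hRic (ΦA z)
  rw [← h1, h2, h3]
  rfl

/-- **The Ricci bridge (pointwise form).** If the spacetime metric is Ricci flat and `Φ : U → M` is a
smooth chart map, then at every `x ∈ U` where the lab metric is within operator distance `< 1` of `η`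
(so nondegenerate on a neighbourhood, on which `Φ` is therefore an immersion) the coordinate Ricci
form of the lab metric vanishes: `MetricCoord.ricAt (G + deviationExtend B Φ) x = 0`.
[cite: ONeill1983, Ch. 3, Prop. 3.59 and Lemma 3.52] -/
theorem ricAt_bilin_add_deviationExtend_eq_zero_of_norm_sub_lt (hΦ : ContMDiff 𝓘(ℝ, E4) (𝓡 4) ∞ Φ)
    (hRic : ∀ [𝓢.metric.toPseudoRiemannianMetric.HasLeviCivita],
      𝓢.metric.toPseudoRiemannianMetric.IsRicciFlat)
    {x : E4} (hx : x ∈ B.domain)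
    (hη : ‖(B.bilin x + 𝓢.deviationExtend B Φ x) - Minkowski.bilin‖ < 1) :
    MetricCoord.ricAt (fun y ↦ B.bilin y + 𝓢.deviationExtend B Φ y) x = 0 := by
  -- the open set `A = {y ∈ U | ‖lab(y) − η‖ < 1}`
  have hcont := continuousOn_bilin_add_deviationExtend 𝓢 B hΦ
  have hO : IsOpen ((B.domain : Set E4) ∩
      (fun y ↦ B.bilin y + 𝓢.deviationExtend B Φ y) ⁻¹' Metric.ball Minkowski.bilin 1) :=
    hcont.isOpen_inter_preimage B.domain.2 Metric.isOpen_ball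
  set A : Opens E4 := ⟨(B.domain : Set E4) ∩
      (fun y ↦ B.bilin y + 𝓢.deviationExtend B Φ y) ⁻¹' Metric.ball Minkowski.bilin 1, hO⟩ with hAdef
  have hA : A ≤ B.domain := fun y hy ↦ hy.1
  have hxA : x ∈ A := by
    refine ⟨hx, ?_⟩
    have h := (mem_ball_iff_norm (a := Minkowski.bilin) (b := B.bilin x + 𝓢.deviationExtend B Φ x)
      (r := 1)).mpr hη
    exact h
  have hAlt : ∀ y ∈ A, ‖(B.bilin y + 𝓢.deviationExtend B Φ y) - Minkowski.bilin‖ < 1 := by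
    intro y hy
    have h := (mem_ball_iff_norm (a := Minkowski.bilin) (b := B.bilin y + 𝓢.deviationExtend B Φ y)
      (r := 1)).mp hy.2
    exact h
  have hinj : ∀ z : A, Injective (mfderiv 𝓘(ℝ, E4) (𝓡 4) Φ (Opens.inclusion hA z)) := fun z ↦
    injective_mfderiv_of_nondegenerate 𝓢 B Φ (Opens.inclusion hA z)
      (nondegenerate_of_norm_sub_minkowski_lt_one (hAlt z.1 z.2))
  exact ricAt_bilin_add_deviationExtend_eq_zero 𝓢 B hΦ hRic hA hinj ⟨x, hxA⟩

end LabMetric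

/-- Registered sub-goal form (stub `labMetric_ricAt_eq_zero_of_norm_sub_lt` of the crux item) of
`LabMetric.ricAt_bilin_add_deviationExtend_eq_zero_of_norm_sub_lt`: **the Ricci bridge** — for a smooth
chart map into a Ricci-flat spacetime, the coordinate Ricci form of the lab metric `G + deviationExtend`
vanishes at every point of the domain where the lab metric is within operator distance `< 1` of `η`.
[cite: ONeill1983, Ch. 3, Prop. 3.59 and Lemma 3.52] -/
theorem labMetric_ricAt_eq_zero_of_norm_sub_lt : open Literature.Geometry.Lorentzian in ∀ (𝓢 : Spacetime 4) (B : ModelBackground) (Φ : B.domain → 𝓢.carrier), ContMDiff 𝓘(ℝ, E4) (𝓡 4) ((⊤ : ℕ∞) : WithTop ℕ∞) Φ → (∀ [𝓢.metric.toPseudoRiemannianMetric.HasLeviCivita], 𝓢.metric.toPseudoRiemannianMetric.IsRicciFlat) → ∀ (x : E4), x ∈ (B.domain : Set E4) → ‖(B.bilin x + 𝓢.deviationExtend B Φ x) - Minkowski.bilin‖ < 1 → MetricCoord.ricAt (fun y ↦ B.bilin y + 𝓢.deviationExtend B Φ y) x = 0 :=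
  fun 𝓢 B _ hΦ hRic _ hx hη ↦ LabMetric.ricAt_bilin_add_deviationExtend_eq_zero_of_norm_sub_lt 𝓢 B hΦ hRic hx hη

end Summit.FinalStateConjecture.FinalStateConjecture.Theorems

end
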